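import Literature.Barriers.CriticalPhenomena.CoveringLatticeShift
import Literature.Probability.Percolation.SiteEmbDomainCrossing
import Literature.Probability.LatticeModels.IsoradialGraphsProofs
import Literature.Computability.QuantumComplexity.Lemma24Gadget
import HarnessLib

/-!
# Kesten's covering dictionary for `stub_coveringBridge` (line `five-arm-null`, crux `CoveringLeg`)

Helper file `--supports stmt-CriticalPhenomena-6435` (stub `stub_coveringBridge` =
`CardySectorGap.CoveringBridge`, stmt-CriticalPhenomena-7055): the exact combinatorial dictionary
between Beffara's centred square lattice `G_s` in the covering-adapted frame `z` of route
CardySectorGap (`coverZ` below, verbatim that route's `let z`; the Defs module's `zS`) at `q = 0` and bond percolation on `ℤ²` drawn by `squareLatticeEmbedding.z = √2·(x₀ + i x₁)`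
(Beffara 2008 §5.1; Kesten 1982 §3.4):

* `coverVertex f` — the vertex of `ℤ²` sitting at the type-III centre `inr f` (`f.1 + f.2` odd):
  `zS (inr f) = squareLatticeEmbedding.z (coverVertex f)` (`cover_z_inr_eq`); inverse `coverFace`.
* `coverFst x`, `coverSnd x`, `coverEdge x = s(coverFst x, coverSnd x)` — the `ℤ²`-edge whose midpoint is
  the type-I site `inl x` (`cover_dist_coverFst`, `cover_dist_coverSnd`: both endpoints at distance `√2/2`
  from `zS (inl x)`); `coverEdge` is injective with values in the edge set; inverse `coverSite y i` (the
  site on the edge `y — y + eᵢ`).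
* corner lemmas: a type-I site and an odd face centre adjacent in `G_s` are an edge and one of its
  endpoints (`coverVertex_of_corner`); two adjacent type-I sites share an odd corner face
  (`cover_exists_odd_corner`), i.e. their edges share an endpoint.
* `coverMap η = {inl x | coverEdge x ∈ η} ∪ {inr f | f.1 + f.2 odd}` — Kesten's covering configuration of a
  bond configuration `η` (type II closed, type III open), measurable (`measurable_coverMap`).

The measure identity `map coverMap (bondPercolation (zdGraph 2) half) = prodBernoulli (mixedParam 0)` and the
event sandwich are in the companion files `…StubCoveringBridgeCoupling.lean` / `…Sandwich.lean`.
-/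

noncomputable section

namespace Summit.CriticalPhenomena.CardyFormulaZ2.Cruxes.CoveringLeg.FiveArmNull

open Literature.Probability.LatticeModels
open Literature.Probability.Percolation
open Literature.Barriers.CriticalPhenomena (MixedSite mixedParam)
open Literature.Computability.QuantumComplexity.Lemma24 (sqrt2_mul_sqrt2 sqrt2_ne_zero)


/-! ### The dictionary maps -/

/-- The covering-adapted embedding of `G_s` (VERBATIM the `Sum.elim` of the `let z` of every CardySectorGap
item, eta-reduced; the Defs module's `zS` is `fun u => coverZ u`, so `zS = coverZ` by `rfl`): type-I site
`inl (a, b)` at `((a + b) + (b - a + 1) i)/√2`, face centre `inr (k, l)` at `((k + l + 1) + (l - k + 1) i)/√2`.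
Restated here only to keep this file independent of the Defs module. [cite: Beffara2008Universal, §5.1] -/
abbrev coverZ : MixedSite → ℂ :=
  Sum.elim (fun x : ℤ × ℤ => (((x.1 + x.2 : ℤ) : ℂ) + ((x.2 - x.1 + 1 : ℤ) : ℂ) * Complex.I) / (Real.sqrt 2 : ℂ))
    (fun f : ℤ × ℤ => (((f.1 + f.2 + 1 : ℤ) : ℂ) + ((f.2 - f.1 + 1 : ℤ) : ℂ) * Complex.I) / (Real.sqrt 2 : ℂ))


/-- The vertex of `ℤ²` carried by the face centre `inr f` (meaningful for `f.1 + f.2` odd, type III):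
`((f.1 + f.2 + 1)/2, (f.2 - f.1 + 1)/2)`. [cite: Beffara2008Universal, §5.1] -/
def coverVertex (f : ℤ × ℤ) : Site 2 := ![(f.1 + f.2 + 1) / 2, (f.2 - f.1 + 1) / 2]

/-- The (odd, type-III) face of `G_s` whose centre sits on the vertex `y` of `ℤ²`. [cite: Beffara2008Universal, §5.1] -/
def coverFace (y : Site 2) : ℤ × ℤ := (y 0 - y 1, y 0 + y 1 - 1)

/-- First endpoint of the `ℤ²`-edge whose midpoint is the type-I site `inl x`. [cite: Kesten1982, §3.4] -/
def coverFst (x : ℤ × ℤ) : Site 2 := ![(x.1 + x.2) / 2, (x.2 - x.1 + 1) / 2]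

/-- Second endpoint of the `ℤ²`-edge whose midpoint is the type-I site `inl x`. [cite: Kesten1982, §3.4] -/
def coverSnd (x : ℤ × ℤ) : Site 2 := ![(x.1 + x.2 + 1) / 2, (x.2 - x.1 + 2) / 2]

/-- The `ℤ²`-edge of the type-I site `inl x` (Kesten's covering graph: sites of the covering graph are the
edges of `ℤ²`). [cite: Kesten1982, §3.4] -/
def coverEdge (x : ℤ × ℤ) : Sym2 (Site 2) := s(coverFst x, coverSnd x)

/-- The type-I site on the `ℤ²`-edge from `y` in direction `eᵢ`. [cite: Kesten1982, §3.4] -/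
def coverSite (y : Site 2) (i : Fin 2) : ℤ × ℤ :=
  if i = 0 then (y 0 - y 1 + 1, y 0 + y 1) else (y 0 - y 1, y 0 + y 1)

/-- Kesten's covering configuration of a bond configuration `η` of `ℤ²`, read on `G_s` at `q = 0`: the
type-I site `inl x` is open iff its edge `coverEdge x` is open, type-II centres (`f.1 + f.2` even) are
closed, type-III centres (`f.1 + f.2` odd) are open. [cite: Beffara2008Universal, §5.1] -/
def coverMap (η : Set (Sym2 (Site 2))) : Set MixedSite :=
  {v | Sum.elim (fun x : ℤ × ℤ => coverEdge x ∈ η) (fun f : ℤ × ℤ => ¬ Even (f.1 + f.2)) v}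

/-! ### Unfolding lemmas -/

/-- Membership of a type-I site in the covering configuration. [cite: Beffara2008Universal, §5.1] -/
@[simp] theorem cover_inl_mem_coverMap_iff (η : Set (Sym2 (Site 2))) (x : ℤ × ℤ) :
    (Sum.inl x : MixedSite) ∈ coverMap η ↔ coverEdge x ∈ η := Iff.rfl

/-- Membership of a face centre in the covering configuration: exactly the type-III centres.
[cite: Beffara2008Universal, §5.1] -/
@[simp] theorem cover_inr_mem_coverMap_iff (η : Set (Sym2 (Site 2))) (f : ℤ × ℤ) :
    (Sum.inr f : MixedSite) ∈ coverMap η ↔ ¬ Even (f.1 + f.2) := Iff.rfl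

/-- `Site.toComplex` in coordinates. [folklore] -/
theorem cover_toComplex_eq (y : Site 2) :
    Site.toComplex y = (y 0 : ℂ) + (y 1 : ℂ) * Complex.I :=
  Complex.ext (by simp) (by simp)

/-! ### Faces ↔ vertices -/

/-- The face attached to a vertex carries that vertex. [cite: Kesten1982, §3.4] -/
@[simp] theorem coverVertex_coverFace (y : Site 2) : coverVertex (coverFace y) = y := by
  ext j
  fin_cases j <;> simp [coverVertex, coverFace] <;> omega

/-- The face attached to a vertex is odd (type III). [cite: Beffara2008Universal, §5.1] -/
theorem cover_not_even_coverFace (y : Site 2) : ¬ Even ((coverFace y).1 + (coverFace y).2) := by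
  simp only [coverFace, Int.not_even_iff_odd]
  exact ⟨y 0 - 1, by ring⟩

/-- An odd face is the face attached to its vertex. [cite: Kesten1982, §3.4] -/
theorem coverFace_coverVertex {f : ℤ × ℤ} (hf : ¬ Even (f.1 + f.2)) : coverFace (coverVertex f) = f := by
  rw [Int.not_even_iff_odd] at hf
  obtain ⟨k, hk⟩ := hf
  obtain ⟨a, b⟩ := f
  simp only [coverFace, coverVertex, Matrix.cons_val_zero, Matrix.cons_val_one, Prod.mk.injEq] at hk ⊢
  omega

/-- **Type-III centres sit exactly on `√2·ℤ[i]`**: the centre of the face attached to `y` is drawn at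
`squareLatticeEmbedding.z y = √2 (y₀ + i y₁)`. [cite: Beffara2008Universal, §5.1] -/
theorem cover_coverZ_inr_coverFace : ∀ y : Literature.Probability.LatticeModels.Site 2, Summit.CriticalPhenomena.CardyFormulaZ2.Cruxes.CoveringLeg.FiveArmNull.coverZ (Sum.inr (Summit.CriticalPhenomena.CardyFormulaZ2.Cruxes.CoveringLeg.FiveArmNull.coverFace y)) = Literature.Probability.LatticeModels.squareLatticeEmbedding.z y := by
  intro y
  rw [squareLatticeEmbedding_z, cover_toComplex_eq]
  simp only [coverZ, Sum.elim_inr, coverFace]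
  have h1 : (y 0 - y 1 + (y 0 + y 1 - 1) + 1 : ℤ) = 2 * y 0 := by ring
  have h2 : (y 0 + y 1 - 1 - (y 0 - y 1) + 1 : ℤ) = 2 * y 1 := by ring
  rw [h1, h2, div_eq_iff sqrt2_ne_zero]
  push_cast
  linear_combination (-((y 0 : ℂ) + (y 1 : ℂ) * Complex.I)) * sqrt2_mul_sqrt2

/-- The same for an odd face `f`: `zS (inr f) = squareLatticeEmbedding.z (coverVertex f)`.
[cite: Beffara2008Universal, §5.1] -/
theorem cover_z_inr_eq {f : ℤ × ℤ} (hf : ¬ Even (f.1 + f.2)) :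
    coverZ (Sum.inr f) = squareLatticeEmbedding.z (coverVertex f) := by
  conv_lhs => rw [← coverFace_coverVertex hf]
  exact cover_coverZ_inr_coverFace _

/-! ### Sites ↔ edges -/

/-- The edge of the site on `y — y + eᵢ` starts at `y`. [cite: Kesten1982, §3.4] -/
@[simp] theorem coverFst_coverSite (y : Site 2) (i : Fin 2) : coverFst (coverSite y i) = y := by
  ext j
  fin_cases i <;> fin_cases j <;> simp [coverFst, coverSite] <;> omega

/-- The edge of the site on `y — y + eᵢ` ends at `y + eᵢ`. [cite: Kesten1982, §3.4] -/
@[simp] theorem coverSnd_coverSite (y : Site 2) (i : Fin 2) :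
    coverSnd (coverSite y i) = y + Pi.single i 1 := by
  ext j
  fin_cases i <;> fin_cases j <;> simp [coverSnd, coverSite] <;> omega

/-- The edge of the site on `y — y + eᵢ` is `s(y, y + eᵢ)`. [cite: Kesten1982, §3.4] -/
theorem coverEdge_coverSite (y : Site 2) (i : Fin 2) :
    coverEdge (coverSite y i) = s(y, y + Pi.single i 1) := by
  rw [coverEdge, coverFst_coverSite, coverSnd_coverSite]

/-- The two endpoints of the edge of a type-I site are adjacent in `ℤ²` (vertical edge if `x.1 + x.2` is
even, horizontal if odd). [cite: Kesten1982, §3.4] -/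
theorem cover_adj_coverFst_coverSnd (x : ℤ × ℤ) :
    (zdGraph 2).Adj (coverFst x) (coverSnd x) := by
  rw [zdGraph_adj_iff]
  rcases Int.even_or_odd (x.1 + x.2) with ⟨k, hk⟩ | ⟨k, hk⟩
  · refine ⟨1, Or.inl ?_⟩
    ext j
    fin_cases j <;> simp [coverFst, coverSnd] <;> omega
  · refine ⟨0, Or.inl ?_⟩
    ext j
    fin_cases j <;> simp [coverFst, coverSnd] <;> omega

/-- The edge of a type-I site is an edge of `ℤ²`. [cite: Kesten1982, §3.4] -/
theorem coverEdge_mem_edgeSet (x : ℤ × ℤ) : coverEdge x ∈ (zdGraph 2).edgeSet :=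
  (SimpleGraph.mem_edgeSet _).2 (cover_adj_coverFst_coverSnd x)

/-- The two endpoints are distinct. [folklore] -/
theorem coverFst_ne_coverSnd (x : ℤ × ℤ) : coverFst x ≠ coverSnd x :=
  (cover_adj_coverFst_coverSnd x).ne

/-- Distinct type-I sites have distinct edges. [cite: Kesten1982, §3.4] -/
theorem coverEdge_injective : Function.Injective coverEdge := by
  intro x y h
  rcases Sym2.eq_iff.1 h with ⟨h1, h2⟩ | ⟨h1, h2⟩
  · have e1 := congrFun h1 0
    have e2 := congrFun h1 1
    have e3 := congrFun h2 0
    have e4 := congrFun h2 1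
    simp only [coverFst, coverSnd, Matrix.cons_val_zero, Matrix.cons_val_one] at e1 e2 e3 e4
    obtain ⟨a, b⟩ := x
    obtain ⟨c, d⟩ := y
    simp only [Prod.mk.injEq] at *
    omega
  · have e1 := congrFun h1 0
    have e2 := congrFun h1 1
    have e3 := congrFun h2 0
    have e4 := congrFun h2 1
    simp only [coverFst, coverSnd, Matrix.cons_val_zero, Matrix.cons_val_one] at e1 e2 e3 e4
    obtain ⟨a, b⟩ := x
    obtain ⟨c, d⟩ := y
    simp only [Prod.mk.injEq] at *
    omega

/-- Every edge of `ℤ²` is the edge of a (unique) type-I site. [cite: Kesten1982, §3.4] -/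
theorem cover_exists_coverEdge_eq {y y' : Site 2} (h : (zdGraph 2).Adj y y') :
    ∃ x : ℤ × ℤ, coverEdge x = s(y, y') := by
  obtain ⟨i, h | h⟩ := (zdGraph_adj_iff y y').1 h
  · exact ⟨coverSite y i, by rw [coverEdge_coverSite, h]⟩
  · exact ⟨coverSite y' i, by rw [coverEdge_coverSite, ← h, Sym2.eq_swap]⟩

/-- Norms after clearing the denominator `√2`: if `√2 · w = u` with `‖u‖ = 1` then `‖w‖ = √2/2`.
[folklore] -/
theorem cover_norm_eq_of_sqrt_two_mul {w u : ℂ} (h : (Real.sqrt 2 : ℂ) * w = u) (hu : ‖u‖ = 1) :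
    ‖w‖ = Real.sqrt 2 / 2 := by
  have hs2 : (0 : ℝ) ≤ Real.sqrt 2 := Real.sqrt_nonneg 2
  have h1 : Real.sqrt 2 * ‖w‖ = 1 := by
    have := congrArg norm h
    rwa [norm_mul, Complex.norm_real, Real.norm_of_nonneg hs2, hu] at this
  have h2 : Real.sqrt 2 * Real.sqrt 2 = 2 := Real.mul_self_sqrt zero_le_two
  calc ‖w‖ = (Real.sqrt 2 * Real.sqrt 2) * ‖w‖ / 2 := by rw [h2]; ring
    _ = Real.sqrt 2 * (Real.sqrt 2 * ‖w‖) / 2 := by ring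
    _ = Real.sqrt 2 / 2 := by rw [h1, mul_one]

/-- **Type-I sites are the edge midpoints**: the first endpoint of the edge of `inl x` is drawn at
distance `√2/2` (half an edge of `√2·ℤ²`) from `zS (inl x)`. [cite: Beffara2008Universal, §5.1] -/
theorem cover_dist_coverFst (x : ℤ × ℤ) :
    dist (squareLatticeEmbedding.z (coverFst x)) (coverZ (Sum.inl x)) = Real.sqrt 2 / 2 := by
  rw [squareLatticeEmbedding_z, cover_toComplex_eq, Complex.dist_eq]
  simp only [coverZ, Sum.elim_inl, coverFst, Matrix.cons_val_zero, Matrix.cons_val_one]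
  rcases Int.even_or_odd (x.1 + x.2) with ⟨k, hk⟩ | ⟨k, hk⟩
  · have h1 : (x.1 + x.2) / 2 = k := by omega
    have h2 : (x.2 - x.1 + 1) / 2 = k - x.1 := by omega
    have h3 : (x.1 + x.2 : ℤ) = 2 * k := by omega
    have h4 : (x.2 - x.1 + 1 : ℤ) = 2 * (k - x.1) + 1 := by omega
    rw [h1, h2, h3, h4]
    refine cover_norm_eq_of_sqrt_two_mul (u := -Complex.I) ?_ (by simp)
    rw [mul_sub, mul_div_cancel₀ _ sqrt2_ne_zero, ← mul_assoc, sqrt2_mul_sqrt2]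
    push_cast
    ring
  · have h1 : (x.1 + x.2) / 2 = k := by omega
    have h2 : (x.2 - x.1 + 1) / 2 = k - x.1 + 1 := by omega
    have h3 : (x.1 + x.2 : ℤ) = 2 * k + 1 := by omega
    have h4 : (x.2 - x.1 + 1 : ℤ) = 2 * (k - x.1 + 1) := by omega
    rw [h1, h2, h3, h4]
    refine cover_norm_eq_of_sqrt_two_mul (u := -1) ?_ (by simp)
    rw [mul_sub, mul_div_cancel₀ _ sqrt2_ne_zero, ← mul_assoc, sqrt2_mul_sqrt2]
    push_cast
    ring

/-- … and so is the second endpoint. [cite: Beffara2008Universal, §5.1] -/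
theorem cover_dist_coverSnd (x : ℤ × ℤ) :
    dist (squareLatticeEmbedding.z (coverSnd x)) (coverZ (Sum.inl x)) = Real.sqrt 2 / 2 := by
  rw [squareLatticeEmbedding_z, cover_toComplex_eq, Complex.dist_eq]
  simp only [coverZ, Sum.elim_inl, coverSnd, Matrix.cons_val_zero, Matrix.cons_val_one]
  rcases Int.even_or_odd (x.1 + x.2) with ⟨k, hk⟩ | ⟨k, hk⟩
  · have h1 : (x.1 + x.2 + 1) / 2 = k := by omega
    have h2 : (x.2 - x.1 + 2) / 2 = k - x.1 + 1 := by omega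
    have h3 : (x.1 + x.2 : ℤ) = 2 * k := by omega
    have h4 : (x.2 - x.1 + 1 : ℤ) = 2 * (k - x.1 + 1) - 1 := by omega
    rw [h1, h2, h3, h4]
    refine cover_norm_eq_of_sqrt_two_mul (u := Complex.I) ?_ (by simp)
    rw [mul_sub, mul_div_cancel₀ _ sqrt2_ne_zero, ← mul_assoc, sqrt2_mul_sqrt2]
    push_cast
    ring
  · have h1 : (x.1 + x.2 + 1) / 2 = k + 1 := by omega
    have h2 : (x.2 - x.1 + 2) / 2 = k - x.1 + 1 := by omega
    have h3 : (x.1 + x.2 : ℤ) = 2 * (k + 1) - 1 := by omega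
    have h4 : (x.2 - x.1 + 1 : ℤ) = 2 * (k - x.1 + 1) := by omega
    rw [h1, h2, h3, h4]
    refine cover_norm_eq_of_sqrt_two_mul (u := 1) ?_ (by simp)
    rw [mul_sub, mul_div_cancel₀ _ sqrt2_ne_zero, ← mul_assoc, sqrt2_mul_sqrt2]
    push_cast
    ring

/-- `√2/2 < 1`. [folklore] -/
theorem cover_sqrt_two_div_two_lt_one : Real.sqrt 2 / 2 < 1 := by
  rw [div_lt_one two_pos]
  have h : Real.sqrt 2 < Real.sqrt 4 := Real.sqrt_lt_sqrt (by norm_num) (by norm_num)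
  have h4 : Real.sqrt 4 = 2 := by
    rw [show (4 : ℝ) = 2 ^ 2 by norm_num, Real.sqrt_sq zero_le_two]
  linarith

/-- The type-I site on `y — y + eᵢ` is drawn at distance `√2/2` from `squareLatticeEmbedding.z y`.
[cite: Beffara2008Universal, §5.1] -/
theorem cover_dist_coverSite (y : Site 2) (i : Fin 2) :
    dist (coverZ (Sum.inl (coverSite y i))) (squareLatticeEmbedding.z y) = Real.sqrt 2 / 2 := by
  rw [dist_comm, ← cover_dist_coverFst (coverSite y i), coverFst_coverSite]

/-! ### Corner lemmas (adjacency of `G_s` in the dictionary) -/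

/-- **A type-I site adjacent to an odd face centre is an edge at that vertex**: if `inl x` is a corner of
the odd face `f`, then `coverVertex f` is an endpoint of `coverEdge x`. [cite: Beffara2008Universal, §5.1] -/
theorem coverVertex_of_corner {x f : ℤ × ℤ}
    (hc : (x.1 = f.1 ∨ x.1 = f.1 + 1) ∧ (x.2 = f.2 ∨ x.2 = f.2 + 1)) (hf : ¬ Even (f.1 + f.2)) :
    coverVertex f = coverFst x ∨ coverVertex f = coverSnd x := by
  rw [Int.not_even_iff_odd] at hf
  obtain ⟨k, hk⟩ := hf
  obtain ⟨a, b⟩ := x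
  obtain ⟨c, d⟩ := f
  simp only at hc hk
  rcases hc with ⟨h1 | h1, h2 | h2⟩
  · right; ext j; fin_cases j <;> simp [coverVertex, coverSnd] <;> omega
  · left; ext j; fin_cases j <;> simp [coverVertex, coverFst] <;> omega
  · right; ext j; fin_cases j <;> simp [coverVertex, coverSnd] <;> omega
  · left; ext j; fin_cases j <;> simp [coverVertex, coverFst] <;> omega

/-- The vertex of an odd corner face of `inl x` lies on the edge of `x`. [cite: Beffara2008Universal, §5.1] -/
theorem coverVertex_mem_coverEdge {x f : ℤ × ℤ}
    (hc : (x.1 = f.1 ∨ x.1 = f.1 + 1) ∧ (x.2 = f.2 ∨ x.2 = f.2 + 1)) (hf : ¬ Even (f.1 + f.2)) :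
    coverVertex f ∈ coverEdge x := by
  rcases coverVertex_of_corner hc hf with h | h
  · rw [h, coverEdge]; exact Sym2.mem_mk_left _ _
  · rw [h, coverEdge]; exact Sym2.mem_mk_right _ _

/-- Type-I adjacency in `G_s`, unfolded: `inl x ∼ inl y` iff `y = x ± e₁` or `y = x ± e₂`.
[cite: Beffara2008Universal, §5.1] -/
theorem cover_adj_inl_inl_iff (x y : ℤ × ℤ) :
    centredSquareGraph.Adj (Sum.inl x) (Sum.inl y) ↔
      y = (x.1 + 1, x.2) ∨ y = (x.1, x.2 + 1) ∨ x = (y.1 + 1, y.2) ∨ x = (y.1, y.2 + 1) := by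
  rw [centredSquareGraph_adj_iff]
  constructor
  · rintro ⟨-, ⟨x', hx', h⟩ | ⟨y', hy', h⟩⟩
    · obtain rfl : x = x' := Sum.inl_injective hx'
      rcases h with h | h | ⟨f, hf, -⟩
      · exact Or.inl (Sum.inl_injective h)
      · exact Or.inr (Or.inl (Sum.inl_injective h))
      · exact absurd hf Sum.inl_ne_inr
    · obtain rfl : y = y' := Sum.inl_injective hy'
      rcases h with h | h | ⟨f, hf, -⟩
      · exact Or.inr (Or.inr (Or.inl (Sum.inl_injective h)))
      · exact Or.inr (Or.inr (Or.inr (Sum.inl_injective h)))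
      · exact absurd hf Sum.inl_ne_inr
  · intro h
    refine ⟨?_, ?_⟩
    · intro hxy
      have hxy' : x = y := Sum.inl_injective hxy
      obtain ⟨a, b⟩ := x
      obtain ⟨c, d⟩ := y
      simp only [Prod.mk.injEq] at h hxy'
      omega
    · rcases h with rfl | rfl | rfl | rfl
      · exact Or.inl ⟨x, rfl, Or.inl rfl⟩
      · exact Or.inl ⟨x, rfl, Or.inr (Or.inl rfl)⟩
      · exact Or.inr ⟨y, rfl, Or.inl rfl⟩
      · exact Or.inr ⟨y, rfl, Or.inr (Or.inl rfl)⟩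

/-- **Adjacent type-I sites share an odd corner face** (two perpendicular `ℤ²`-edges at a common vertex):
if `inl x ∼ inl y` in `G_s` then some odd face `f` has both `x` and `y` among its corners.
[cite: Beffara2008Universal, §5.1] -/
theorem cover_exists_odd_corner {x y : ℤ × ℤ} (h : centredSquareGraph.Adj (Sum.inl x) (Sum.inl y)) :
    ∃ f : ℤ × ℤ, ¬ Even (f.1 + f.2) ∧
      ((x.1 = f.1 ∨ x.1 = f.1 + 1) ∧ (x.2 = f.2 ∨ x.2 = f.2 + 1)) ∧
      ((y.1 = f.1 ∨ y.1 = f.1 + 1) ∧ (y.2 = f.2 ∨ y.2 = f.2 + 1)) := by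
  rw [cover_adj_inl_inl_iff] at h
  obtain ⟨a, b⟩ := x
  obtain ⟨c, d⟩ := y
  simp only [Prod.mk.injEq] at h ⊢
  rcases Int.even_or_odd (a + b) with ⟨k, hk⟩ | ⟨k, hk⟩
  · rcases h with ⟨h1, h2⟩ | ⟨h1, h2⟩ | ⟨h1, h2⟩ | ⟨h1, h2⟩
    · exact ⟨(a, b - 1), by rw [Int.not_even_iff_odd]; exact ⟨k - 1, by omega⟩, by omega⟩
    · exact ⟨(a - 1, b), by rw [Int.not_even_iff_odd]; exact ⟨k - 1, by omega⟩, by omega⟩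
    · exact ⟨(c, d), by rw [Int.not_even_iff_odd]; exact ⟨k - 1, by omega⟩, by omega⟩
    · exact ⟨(c, d), by rw [Int.not_even_iff_odd]; exact ⟨k - 1, by omega⟩, by omega⟩
  · rcases h with ⟨h1, h2⟩ | ⟨h1, h2⟩ | ⟨h1, h2⟩ | ⟨h1, h2⟩
    · exact ⟨(a, b), by rw [Int.not_even_iff_odd]; exact ⟨k, by omega⟩, by omega⟩
    · exact ⟨(a, b), by rw [Int.not_even_iff_odd]; exact ⟨k, by omega⟩, by omega⟩
    · exact ⟨(c, d - 1), by rw [Int.not_even_iff_odd]; exact ⟨k - 1, by omega⟩, by omega⟩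
    · exact ⟨(c - 1, d), by rw [Int.not_even_iff_odd]; exact ⟨k - 1, by omega⟩, by omega⟩

/-- The site on `y — y + eᵢ` is a corner of the face attached to `y` … [cite: Beffara2008Universal, §5.1] -/
theorem cover_adj_coverSite_coverFace (y : Site 2) (i : Fin 2) :
    centredSquareGraph.Adj (Sum.inl (coverSite y i)) (Sum.inr (coverFace y)) := by
  rw [centredSquareGraph_adj_inl_inr_iff]
  fin_cases i <;> simp [coverSite, coverFace]

/-- … and of the face attached to `y + eᵢ`. [cite: Beffara2008Universal, §5.1] -/
theorem cover_adj_coverSite_coverFace_add (y : Site 2) (i : Fin 2) :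
    centredSquareGraph.Adj (Sum.inl (coverSite y i)) (Sum.inr (coverFace (y + Pi.single i 1))) := by
  rw [centredSquareGraph_adj_inl_inr_iff]
  fin_cases i <;> simp [coverSite, coverFace] <;> omega

/-! ### Measurability of the covering map -/

/-- The covering configuration depends measurably on the bond configuration (each coordinate is a
coordinate of `η` or a constant). [folklore] -/
theorem measurable_coverMap : Measurable coverMap := by
  refine measurable_set_iff.2 fun v => ?_
  cases v with
  | inl x => exact measurable_set_mem (coverEdge x)
  | inr f => exact measurable_const

end Summit.CriticalPhenomena.CardyFormulaZ2.Cruxes.CoveringLeg.FiveArmNull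

end
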